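import Summits.QuantumFields.QCD.Theorems.SpectralDefectExtinctionWindowExtinctionFluxColourDiagonal
import Summits.QuantumFields.QCD.Theorems.SpectralDefectExtinctionWindowExtinctionFluxPlaquette
import Summits.QuantumFields.QCD.Theorems.SpectralDefectExtinctionWindowExtinctionFluxTransportHJL
import Summits.QuantumFields.QCD.Theorems.ExtinctionBuildsQCD.Negative.InertiaPencil
import Literature.MathematicalPhysics.QuantumLattice.AbelianFluxSectors
import HarnessLib

/-!
# The periodic index carrier from the HJL gap and the IOS abelian index formula (stub S11, conditional)

Residual stub S11 `stub_periodicIndexCarrier` of line `free-volume-heavy-witness` (reshape r4) of crux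
`Summit.QuantumFields.QCD.Theses.SpectralDefectExtinction.WindowExtinction` (item stmt-QuantumFields-8964), proved
CONDITIONALLY on two published named facts of the tree:

* `HJLLocality (fundamentalRep (Fin 3))` (Hernández–Jansen–Lüscher 1999 (2.16): `D_W(−1)ᴴD_W(−1) ≥ 1 − 30ε` for
  norm-admissible fields; `Literature/MathematicalPhysics/QuantumLattice/OverlapLocality.lean`), and
* `IOSFluxSectorIndex` (Igarashi–Okuyama–Suzuki 2002 Thm 3.1 + (2.3), (3.4), read through Fujiwara 2002 (2.2): the negative
  count of `Γ₅ D_W(V_{[m]}, −1, 1)` for Lüscher's flux-sector field is `2L⁴ + s·Q₂(m)`;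
  `Literature/MathematicalPhysics/QuantumLattice/AbelianFluxSectors.lean`).

Construction.  Given a window `[lo, hi] ⊆ (0, 1/4]` put `c = lo²/60`, take an odd side `L = 2R+1 ≥ max(L₁, 24704/c²)`,
`ν = ⌊cL²/(2π)⌋` flux quanta, the flux tensor `m₀₁ = ν`, `m₂₃ = sν` (antisymmetrised), and the colour-diagonal `SU(3)` field
`U₀ = diag(V_{[m]}, V_{[m]}⁻¹ = V_{[−m]}, 1 = V_{[0]})` (`flux_exists_diagonalSU3`).  Then
`n₋(Γ₅ D_W(U₀, −1, 1)) = (2L⁴ + ν²) + (2L⁴ + ν²) + 2L⁴` (landed `flux_negCount_colourDiagonal` + the fact at `m, −m, 0`;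
`s·Q₂(±m) = s²ν² = ν²`), the field is norm-admissible with `ε = c` (landed `flux_plaquette_fluxSector`,
`flux_norm_one_sub_circleExp_le`, `flux_normAdmissible_of_diagonal`: every plaquette is `diag(e^{iθ}, e^{−iθ}, 1)`,
`|θ| ≤ 2πν/L² ≤ c`), so the HJL gap transports the count unchanged to every `δ ∈ [lo, 1] ⊇ [lo, hi]` (landed
`flux_transport_of_HJL`, `30c < lo²`), and `2ν² ≥ 96L³ + 1 + 12(L⁴ − (L−2)⁴)` by the choice of `L` (`flux_arith`).
-/

noncomputable section

namespace Summit.QuantumFields.QCD.Cruxes.WindowExtinction.FreeVolumeHeavyWitness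

open Matrix
open Literature.MathematicalPhysics Literature.MathematicalPhysics.QuantumLattice
  Literature.MathematicalPhysics.QuantumFieldTheory Literature.Probability.LatticeModels
open Summit.QuantumFields.QCD.Theorems.ExtinctionBuildsQCD.Negative
open scoped BigOperators

/-! ## The colour-diagonal `SU(3)` embedding `diag(V, V⁻¹, 1)` of a `U(1)` field -/

/-- A unit complex number times its conjugate is `1`. -/
theorem flux_circle_mul_star (z : Circle) : (z : ℂ) * star (z : ℂ) = 1 := by
  rw [Complex.star_def, Complex.mul_conj, Circle.normSq_coe, Complex.ofReal_one]

/-- **The diagonal `SU(3)` embedding.**  For every `U(1)` link field `V` there is an `SU(3)` link field whose matrices are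
`diag(V(e), V(e)⁻¹, 1)`. -/
theorem flux_exists_diagonalSU3 {L : ℕ} (V : GaugeConfig 4 L Circle) :
    ∃ U : GaugeConfig 4 L SU3, ∀ e, ((U e : SU3) : Matrix (Fin 3) (Fin 3) ℂ) =
      Matrix.diagonal fun a => ((![V, V⁻¹, 1] a e : Circle) : ℂ) := by
  have hmem : ∀ e, (Matrix.diagonal fun a => ((![V, V⁻¹, 1] a e : Circle) : ℂ)) ∈
      Matrix.specialUnitaryGroup (Fin 3) ℂ := by
    intro e
    rw [Matrix.mem_specialUnitaryGroup_iff]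
    refine ⟨?_, ?_⟩
    · rw [Matrix.mem_unitaryGroup_iff, Matrix.star_eq_conjTranspose, Matrix.diagonal_conjTranspose,
        Matrix.diagonal_mul_diagonal, ← Matrix.diagonal_one]
      congr 1
      funext a
      rw [Pi.star_apply]
      exact flux_circle_mul_star _
    · rw [Matrix.det_diagonal, Fin.prod_univ_three]
      simp only [Matrix.cons_val_zero, Matrix.cons_val_one, Matrix.head_cons, Matrix.cons_val_two,
        Matrix.tail_cons, Pi.inv_apply, Pi.one_apply, Circle.coe_inv, Circle.coe_one, mul_one]
      exact mul_inv_cancel₀ (Circle.coe_ne_zero _)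
  exact ⟨fun e => ⟨_, hmem e⟩, fun e => rfl⟩

/-! ## Arithmetic of the construction -/

/-- `(2R+1)⁴ − (2R−1)⁴ ≤ 8(2R+1)³` in `ℕ` (truncated subtraction; for `R = 0` it reads `1 ≤ 8`). -/
theorem flux_face_le (R : ℕ) : (2 * R + 1) ^ 4 - (2 * R - 1) ^ 4 ≤ 8 * (2 * R + 1) ^ 3 := by
  rcases Nat.eq_zero_or_pos R with rfl | hR
  · norm_num
  · obtain ⟨k, rfl⟩ : ∃ k, R = k + 1 := ⟨R - 1, by omega⟩
    have h2 : 2 * (k + 1) - 1 = 2 * k + 1 := by omega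
    rw [h2, tsub_le_iff_right]
    have : (2 * (k + 1) + 1) ^ 4 = 8 * (2 * k + 1) ^ 3 + 24 * (2 * k + 1) ^ 2 + 32 * (2 * k + 1) + 16 +
        (2 * k + 1) ^ 4 := by ring
    rw [this]
    have h3 : 8 * (2 * k + 1) ^ 3 + 24 * (2 * k + 1) ^ 2 + 32 * (2 * k + 1) + 16 ≤ 8 * (2 * (k + 1) + 1) ^ 3 := by
      have : 8 * (2 * (k + 1) + 1) ^ 3 = 8 * (2 * k + 1) ^ 3 + 48 * (2 * k + 1) ^ 2 + 96 * (2 * k + 1) + 64 := by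
        ring
      rw [this]
      omega
    omega

/-- **Choice of side and flux.**  For `0 < c ≤ 1` and any `L₁` there are `R, ν ∈ ℕ` with `L = 2R+1 ≥ L₁`,
`2πν ≤ cL²` and `96L³ + 1 + 12(L⁴ − (L−2)⁴) ≤ 2ν²`: take `R = max L₁ ⌈24704/c²⌉`, `ν = ⌊cL²/(2π)⌋`. -/
theorem flux_arith (c : ℝ) (hc : 0 < c) (hc1 : c ≤ 1) (L₁ : ℕ) :
    ∃ R ν : ℕ, L₁ ≤ 2 * R + 1 ∧ 2 * Real.pi * (ν : ℝ) ≤ c * ((2 * R + 1 : ℕ) : ℝ) ^ 2 ∧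
      96 * (2 * R + 1) ^ 3 + 1 + 12 * ((2 * R + 1) ^ 4 - (2 * R - 1) ^ 4) ≤ 2 * ν ^ 2 := by
  set R : ℕ := max L₁ ⌈24704 / c ^ 2⌉₊ with hR
  set Lr : ℝ := ((2 * R + 1 : ℕ) : ℝ) with hLr
  set ν : ℕ := ⌊c * Lr ^ 2 / (2 * Real.pi)⌋₊ with hν
  have hpi : 0 < Real.pi := Real.pi_pos
  have hpi4 : Real.pi < 4 := Real.pi_lt_four
  have hR₁ : L₁ ≤ R := le_max_left _ _
  have hRc : 24704 / c ^ 2 ≤ (R : ℝ) := (Nat.le_ceil _).trans (by exact_mod_cast le_max_right _ _)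
  have hLr1 : (R : ℝ) + 1 ≤ Lr := by
    rw [hLr]; push_cast; linarith [(Nat.cast_nonneg R : (0 : ℝ) ≤ R)]
  have hc2 : 0 < c ^ 2 := by positivity
  have hLc : 24704 ≤ c ^ 2 * Lr := by
    have : 24704 / c ^ 2 * c ^ 2 = 24704 := div_mul_cancel₀ _ hc2.ne'
    nlinarith
  have hLr0 : 0 < Lr := by rw [hLr]; positivity
  -- `c L² / (2π) ≥ 2`, so the floor loses at most half
  have hx2 : 2 ≤ c * Lr ^ 2 / (2 * Real.pi) := by
    rw [le_div_iff₀ (by positivity)]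
    have hc2le : c ^ 2 ≤ c := by nlinarith
    have h1 : 24704 ≤ c * Lr := by nlinarith
    have h2 : 1 ≤ Lr := by
      have : (0 : ℝ) ≤ R := Nat.cast_nonneg R
      linarith
    nlinarith
  have hνge : c * Lr ^ 2 / (2 * Real.pi) - 1 ≤ (ν : ℝ) := by
    have := Nat.lt_floor_add_one (c * Lr ^ 2 / (2 * Real.pi))
    rw [← hν] at this
    linarith
  have hνle : (ν : ℝ) ≤ c * Lr ^ 2 / (2 * Real.pi) := Nat.floor_le (by positivity)
  refine ⟨R, ν, by omega, ?_, ?_⟩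
  · -- `2πν ≤ cL²`
    rw [← hLr]
    have := mul_le_mul_of_nonneg_left hνle (by positivity : (0 : ℝ) ≤ 2 * Real.pi)
    rwa [mul_div_cancel₀ _ (by positivity : (2 * Real.pi : ℝ) ≠ 0)] at this
  · -- the index inequality, in `ℝ`
    have hface := flux_face_le R
    have hkey : (96 * (2 * R + 1) ^ 3 + 1 + 12 * (8 * (2 * R + 1) ^ 3) : ℕ) ≤ 2 * ν ^ 2 := by
      have hreal : (96 * Lr ^ 3 + 1 + 12 * (8 * Lr ^ 3) : ℝ) ≤ 2 * (ν : ℝ) ^ 2 := by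
        -- `ν ≥ cL²/(4π)` and `c²L⁴/(8π²) ≥ 193 L³`
        have hν4 : c * Lr ^ 2 / (4 * Real.pi) ≤ (ν : ℝ) := by
          have : c * Lr ^ 2 / (4 * Real.pi) = c * Lr ^ 2 / (2 * Real.pi) / 2 := by ring
          rw [this]; linarith
        have hν0 : 0 ≤ c * Lr ^ 2 / (4 * Real.pi) := by positivity
        have hsq : (c * Lr ^ 2 / (4 * Real.pi)) ^ 2 ≤ (ν : ℝ) ^ 2 := pow_le_pow_left₀ hν0 hν4 2
        have hsq' : (c * Lr ^ 2 / (4 * Real.pi)) ^ 2 = c ^ 2 * Lr ^ 4 / (16 * Real.pi ^ 2) := by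
          field_simp; ring
        have hpi2 : Real.pi ^ 2 < 16 := by nlinarith
        have hL1 : 1 ≤ Lr := by
          have : (0 : ℝ) ≤ R := Nat.cast_nonneg R
          linarith
        have hL3 : Lr ^ 3 ≤ Lr ^ 4 := by
          calc Lr ^ 3 = Lr ^ 3 * 1 := by ring
            _ ≤ Lr ^ 3 * Lr := by gcongr
            _ = Lr ^ 4 := by ring
        -- `c² L⁴ ≥ 24704 L³`
        have hcL : 24704 * Lr ^ 3 ≤ c ^ 2 * Lr ^ 4 := by nlinarith [pow_pos hLr0 3]
        have hmain : 193 * Lr ^ 3 ≤ 2 * (c ^ 2 * Lr ^ 4 / (16 * Real.pi ^ 2)) := by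
          rw [mul_div_assoc', le_div_iff₀ (by positivity)]
          nlinarith [pow_pos hLr0 3, mul_pos (pow_pos hLr0 3) (sub_pos.2 hpi2)]
        have h193 : (96 * Lr ^ 3 + 1 + 12 * (8 * Lr ^ 3) : ℝ) ≤ 193 * Lr ^ 3 := by
          nlinarith [pow_pos hLr0 3, one_le_pow₀ (n := 3) hL1]
        linarith [hsq, hsq'.le, hsq'.ge]
      have hcast : ((96 * (2 * R + 1) ^ 3 + 1 + 12 * (8 * (2 * R + 1) ^ 3) : ℕ) : ℝ) ≤ ((2 * ν ^ 2 : ℕ) : ℝ) := by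
        push_cast
        rw [hLr] at hreal
        push_cast at hreal
        linarith
      exact_mod_cast hcast
    calc 96 * (2 * R + 1) ^ 3 + 1 + 12 * ((2 * R + 1) ^ 4 - (2 * R - 1) ^ 4)
        ≤ 96 * (2 * R + 1) ^ 3 + 1 + 12 * (8 * (2 * R + 1) ^ 3) := by gcongr
      _ ≤ 2 * ν ^ 2 := hkey


/-! ## The flux tensor `m₀₁ = ν`, `m₂₃ = sν` -/

/-- Antisymmetry of the two-plane flux tensor. -/
theorem flux_tensor_anti (s ν : ℤ) (μ ν' : Fin 4) :
    (fun a b : Fin 4 => if a = 0 ∧ b = 1 then ν else if a = 1 ∧ b = 0 then -ν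
      else if a = 2 ∧ b = 3 then s * ν else if a = 3 ∧ b = 2 then -(s * ν) else 0) ν' μ =
    -(fun a b : Fin 4 => if a = 0 ∧ b = 1 then ν else if a = 1 ∧ b = 0 then -ν
      else if a = 2 ∧ b = 3 then s * ν else if a = 3 ∧ b = 2 then -(s * ν) else 0) μ ν' := by
  fin_cases μ <;> fin_cases ν' <;> simp

/-- The entries of the two-plane flux tensor are bounded by `|ν|` when `s = ±1`. -/
theorem flux_tensor_abs_le (s ν : ℤ) (hs : s = 1 ∨ s = -1) (μ ν' : Fin 4) :
    |(((fun a b : Fin 4 => if a = 0 ∧ b = 1 then ν else if a = 1 ∧ b = 0 then -ν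
      else if a = 2 ∧ b = 3 then s * ν else if a = 3 ∧ b = 2 then -(s * ν) else 0) μ ν' : ℤ) : ℝ)| ≤ |(ν : ℝ)| := by
  have hsabs : |(s : ℝ)| = 1 := by rcases hs with rfl | rfl <;> simp
  fin_cases μ <;> fin_cases ν' <;> simp [abs_mul, hsabs]

/-- The second Chern number of the two-plane flux tensor is `sν²`. -/
theorem flux_tensor_chern (s ν : ℤ) :
    (fun a b : Fin 4 => if a = 0 ∧ b = 1 then ν else if a = 1 ∧ b = 0 then -ν
      else if a = 2 ∧ b = 3 then s * ν else if a = 3 ∧ b = 2 then -(s * ν) else 0) 0 1 *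
        (fun a b : Fin 4 => if a = 0 ∧ b = 1 then ν else if a = 1 ∧ b = 0 then -ν
          else if a = 2 ∧ b = 3 then s * ν else if a = 3 ∧ b = 2 then -(s * ν) else 0) 2 3 -
      (fun a b : Fin 4 => if a = 0 ∧ b = 1 then ν else if a = 1 ∧ b = 0 then -ν
        else if a = 2 ∧ b = 3 then s * ν else if a = 3 ∧ b = 2 then -(s * ν) else 0) 0 2 *
        (fun a b : Fin 4 => if a = 0 ∧ b = 1 then ν else if a = 1 ∧ b = 0 then -ν
          else if a = 2 ∧ b = 3 then s * ν else if a = 3 ∧ b = 2 then -(s * ν) else 0) 1 3 +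
      (fun a b : Fin 4 => if a = 0 ∧ b = 1 then ν else if a = 1 ∧ b = 0 then -ν
        else if a = 2 ∧ b = 3 then s * ν else if a = 3 ∧ b = 2 then -(s * ν) else 0) 0 3 *
        (fun a b : Fin 4 => if a = 0 ∧ b = 1 then ν else if a = 1 ∧ b = 0 then -ν
          else if a = 2 ∧ b = 3 then s * ν else if a = 3 ∧ b = 2 then -(s * ν) else 0) 1 2 =
      s * ν ^ 2 := by
  simp
  ring

/-! ## Plaquettes of the flux-sector field and its inverse -/

/-- Every plaquette of Lüscher's flux-sector field is within `2π|m_{μν}|/L²` of `1`. -/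
theorem flux_norm_plaquette_fluxSectorField_le {L : ℕ} [NeZero L] (m : Fin 4 → Fin 4 → ℤ)
    (hm : ∀ μ ν, m ν μ = -m μ ν) (x : TorusSite 4 L) (μ ν : Fin 4) :
    ‖(1 : ℂ) - ((plaquetteHolonomy (fluxSectorField L m) x μ ν : Circle) : ℂ)‖ ≤
      2 * Real.pi * |(m μ ν : ℝ)| / (L : ℝ) ^ 2 := by
  have hp : plaquetteHolonomy (fluxSectorField L m) x μ ν =
      Circle.exp (2 * Real.pi * (m μ ν : ℝ) / (L : ℝ) ^ 2) :=
    flux_plaquette_fluxSector L m hm x μ ν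
  rw [hp]
  refine (flux_norm_one_sub_circleExp_le _).trans (le_of_eq ?_)
  rw [abs_div, abs_mul, abs_of_pos (by positivity : (0 : ℝ) < 2 * Real.pi),
    abs_of_nonneg (by positivity : (0 : ℝ) ≤ (L : ℝ) ^ 2)]

/-! ## The stub, conditionally on the two published facts -/

/-- **STUB S11 `stub_periodicIndexCarrier`, CONDITIONAL on `HJLLocality (fundamentalRep (Fin 3))` and
`IOSFluxSectorIndex`.**  For every window `0 < lo ≤ hi ≤ Q·lo`, `hi ≤ 1/4` there are an odd torus side `2R+1` and an
`SU(3)` gauge field `U₀` on it with `n₋(Γ₅ D_W(U₀, −δ, 1)) ≥ 6(2R+1)⁴ + 96(2R+1)³ + 1 + 12((2R+1)⁴ − (2R−1)⁴)` for all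
`δ ∈ [lo, hi]`: the colour-diagonal embedding of Lüscher's flux-sector field (see the module docstring). -/
theorem flux_periodicIndexCarrier_of (hHJL : HJLLocality (fundamentalRep (Fin 3)))
    (hIOS : IOSFluxSectorIndex) :
    ∀ (Q : ℕ) (lo hi : ℝ), 0 < lo → lo ≤ hi → hi ≤ Q * lo → hi ≤ 1 / 4 →
      ∃ (R : ℕ) (U₀ : GaugeConfig 4 (2 * R + 1) SU3), ∀ δ : ℝ, lo ≤ δ → δ ≤ hi →
        6 * (2 * R + 1) ^ 4 + 96 * (2 * R + 1) ^ 3 + 1 + 12 * ((2 * R + 1) ^ 4 - (2 * R - 1) ^ 4) ≤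
          negRootCount (spinorLift gammaFive * wilsonDirac (fundamentalRep (Fin 3)) U₀ (-δ) 1) := by
  intro Q lo hi hlo hlohi _hQ hhi
  obtain ⟨s, L₁, hs, hI⟩ := hIOS
  -- constants of the construction
  set c : ℝ := lo ^ 2 / 60 with hc
  have hlo4 : lo ≤ 1 / 4 := hlohi.trans hhi
  have hc0 : 0 < c := by positivity
  have hlosq : lo ^ 2 ≤ (1 / 4) ^ 2 := pow_le_pow_left₀ hlo.le hlo4 2
  have hc50 : c ≤ 1 / 50 := by rw [hc]; linarith
  have hc1 : c ≤ 1 := by linarith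
  obtain ⟨R, ν, hRL, hνc, hineq⟩ := flux_arith c hc0 hc1 L₁
  have hLpos : (0 : ℝ) < ((2 * R + 1 : ℕ) : ℝ) := by positivity
  -- the flux tensor and the fields
  set m : Fin 4 → Fin 4 → ℤ := fun a b : Fin 4 => if a = 0 ∧ b = 1 then (ν : ℤ) else if a = 1 ∧ b = 0 then -(ν : ℤ)
      else if a = 2 ∧ b = 3 then s * ν else if a = 3 ∧ b = 2 then -(s * ν) else 0 with hmdef
  have hm : ∀ μ ν', m ν' μ = -m μ ν' := fun μ ν' => flux_tensor_anti s ν μ ν'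
  have hnm : ∀ μ ν', (-m) ν' μ = -(-m) μ ν' := fun μ ν' => by simp only [Pi.neg_apply, hm μ ν']
  have hmabs : ∀ μ ν', |(m μ ν' : ℝ)| ≤ (ν : ℝ) := fun μ ν' => by
    have h := flux_tensor_abs_le s ν hs μ ν'
    rwa [Int.cast_natCast, Nat.abs_cast] at h
  have hnmabs : ∀ μ ν', |((-m) μ ν' : ℝ)| ≤ (ν : ℝ) := fun μ ν' => by
    simp only [Pi.neg_apply, Int.cast_neg, abs_neg]; exact hmabs μ ν'
  -- admissibility bounds of the tensor entries: `2π|m| ≤ 2πν ≤ cL² ≤ L²/50`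
  have hbnd : ∀ μ ν', 2 * Real.pi * |(m μ ν' : ℝ)| ≤ ((2 * R + 1 : ℕ) : ℝ) ^ 2 / 50 := fun μ ν' => by
    have h1 : 2 * Real.pi * |(m μ ν' : ℝ)| ≤ 2 * Real.pi * ν :=
      mul_le_mul_of_nonneg_left (hmabs μ ν') (by positivity)
    have h2 : c * ((2 * R + 1 : ℕ) : ℝ) ^ 2 ≤ ((2 * R + 1 : ℕ) : ℝ) ^ 2 / 50 := by
      rw [le_div_iff₀ (by norm_num : (0 : ℝ) < 50)]; nlinarith [sq_nonneg (((2 * R + 1 : ℕ) : ℝ))]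
    linarith
  have hnbnd : ∀ μ ν', 2 * Real.pi * |((-m) μ ν' : ℝ)| ≤ ((2 * R + 1 : ℕ) : ℝ) ^ 2 / 50 := fun μ ν' => by
    simp only [Pi.neg_apply, Int.cast_neg, abs_neg]; exact hbnd μ ν'
  set V : GaugeConfig 4 (2 * R + 1) Circle := fluxSectorField (2 * R + 1) m with hVdef
  obtain ⟨U, hU⟩ := flux_exists_diagonalSU3 (L := 2 * R + 1) V
  refine ⟨R, U, fun δ hδlo hδhi => ?_⟩
  -- the three colour counts at the overlap point `m₀ = 1`
  have hcount0 := hI (2 * R + 1) hRL m hm hbnd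
  have hcount1 := hI (2 * R + 1) hRL (-m) hnm hnbnd
  have hcount2 := hI (2 * R + 1) hRL 0 (fun _ _ => by simp) (fun _ _ => by simp; positivity)
  rw [fluxSectorField_neg, ← hVdef] at hcount1
  rw [fluxSectorField_zero] at hcount2
  rw [← hVdef] at hcount0
  have hQ0 : m 0 1 * m 2 3 - m 0 2 * m 1 3 + m 0 3 * m 1 2 = s * ν ^ 2 := flux_tensor_chern s ν
  have hQ1 : (-m) 0 1 * (-m) 2 3 - (-m) 0 2 * (-m) 1 3 + (-m) 0 3 * (-m) 1 2 = s * ν ^ 2 := by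
    simp only [Pi.neg_apply, neg_mul_neg]; exact hQ0
  have hss : s * s = 1 := by rcases hs with rfl | rfl <;> norm_num
  rw [hQ0] at hcount0
  rw [hQ1] at hcount1
  simp only [Pi.zero_apply, mul_zero, sub_zero, add_zero] at hcount2
  -- colour decomposition of the `SU(3)` count at `m₀ = 1`
  have hsum := flux_negCount_colourDiagonal (2 * R + 1) U ![V, V⁻¹, 1] hU (-1)
  rw [Fin.sum_univ_three] at hsum
  simp only [Matrix.cons_val_zero, Matrix.cons_val_one, Matrix.head_cons, Matrix.cons_val_two,
    Matrix.tail_cons] at hsum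
  -- norm-admissibility with `ε = c`
  have hplaq : ∀ (a : Fin 3) (x : TorusSite 4 (2 * R + 1)) (μ ν' : Fin 4),
      ‖(1 : ℂ) - ((plaquetteHolonomy (![V, V⁻¹, 1] a) x μ ν' : Circle) : ℂ)‖ ≤ c := by
    have hdiv : 2 * Real.pi * (ν : ℝ) / ((2 * R + 1 : ℕ) : ℝ) ^ 2 ≤ c := by
      rw [div_le_iff₀ (by positivity)]; exact hνc
    intro a x μ ν'
    fin_cases a
    · simp only [Fin.zero_eta, Fin.isValue, Matrix.cons_val_zero]
      rw [hVdef]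
      refine (flux_norm_plaquette_fluxSectorField_le m hm x μ ν').trans ?_
      refine le_trans ?_ hdiv
      gcongr
      exact hmabs μ ν'
    · simp only [Fin.mk_one, Fin.isValue, Matrix.cons_val_one]
      rw [hVdef, ← fluxSectorField_neg]
      refine (flux_norm_plaquette_fluxSectorField_le (-m) hnm x μ ν').trans ?_
      refine le_trans ?_ hdiv
      gcongr
      exact hnmabs μ ν'
    · simp only [Fin.reduceFinMk, Matrix.cons_val_two, Matrix.tail_cons, Matrix.head_cons]
      have h1 : plaquetteHolonomy (1 : GaugeConfig 4 (2 * R + 1) Circle) x μ ν' = 1 := by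
        simp [plaquetteHolonomy]
      rw [h1, Circle.coe_one, sub_self, norm_zero]
      exact hc0.le
  have hadm : IsNormAdmissible (fundamentalRep (Fin 3)) U c :=
    flux_normAdmissible_of_diagonal (2 * R + 1) U ![V, V⁻¹, 1] c hU hplaq
  -- transport of the count from `m₀ = 1` to the window by the HJL gap
  have h30 : 30 * c < lo ^ 2 := by rw [hc]; nlinarith [pow_pos hlo 2]
  have hδ1 : δ ≤ 1 := hδhi.trans (hhi.trans (by norm_num))
  obtain ⟨_, htr⟩ := flux_transport_of_HJL (2 * R + 1) U c lo hHJL hadm hlo h30 δ hδlo hδ1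
  rw [negRootCount, htr, hsum]
  -- the arithmetic: each charged colour contributes `2L⁴ + ν²`, the neutral one `2L⁴`
  set c0 := (spinorLift gammaFive * wilsonDirac u1Rep V (-1) 1).charpoly.roots.countP fun z : ℂ => z.re < 0
    with hc0def
  set c1 := (spinorLift gammaFive * wilsonDirac u1Rep V⁻¹ (-1) 1).charpoly.roots.countP fun z : ℂ => z.re < 0
    with hc1def
  set c2 := (spinorLift gammaFive * wilsonDirac u1Rep (1 : GaugeConfig 4 (2 * R + 1) Circle) (-1) 1).charpoly.roots.countP
      fun z : ℂ => z.re < 0 with hc2def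
  have e0 : (c0 : ℤ) = 2 * ((2 * R + 1 : ℕ) : ℤ) ^ 4 + (ν : ℤ) ^ 2 := by
    rw [hcount0]; rw [← mul_assoc, hss, one_mul]
  have e1 : (c1 : ℤ) = 2 * ((2 * R + 1 : ℕ) : ℤ) ^ 4 + (ν : ℤ) ^ 2 := by
    rw [hcount1]; rw [← mul_assoc, hss, one_mul]
  have e2 : (c2 : ℤ) = 2 * ((2 * R + 1 : ℕ) : ℤ) ^ 4 := by rw [hcount2]
  have e0' : c0 = 2 * (2 * R + 1) ^ 4 + ν ^ 2 := by exact_mod_cast e0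
  have e1' : c1 = 2 * (2 * R + 1) ^ 4 + ν ^ 2 := by exact_mod_cast e1
  have e2' : c2 = 2 * (2 * R + 1) ^ 4 := by exact_mod_cast e2
  rw [e0', e1', e2']
  omega


/-- **STUB `stub_periodicIndexCarrier_of` (registered form, hypotheses as arrows):** S11 `PeriodicIndexCarrier` of line
`free-volume-heavy-witness` (r4) from the named facts `HJLLocality (fundamentalRep (Fin 3))` (Hernández–Jansen–Lüscher 1999) and
`IOSFluxSectorIndex` (Igarashi–Okuyama–Suzuki 2002). -/
theorem stub_periodicIndexCarrier_of : HJLLocality (fundamentalRep (Fin 3)) → IOSFluxSectorIndex → ∀ (Q : ℕ) (lo hi : ℝ), 0 < lo → lo ≤ hi → hi ≤ Q * lo → hi ≤ 1 / 4 → ∃ (R : ℕ) (U₀ : GaugeConfig 4 (2 * R + 1) SU3), ∀ δ : ℝ, lo ≤ δ → δ ≤ hi → 6 * (2 * R + 1) ^ 4 + 96 * (2 * R + 1) ^ 3 + 1 + 12 * ((2 * R + 1) ^ 4 - (2 * R - 1) ^ 4) ≤ negRootCount (spinorLift gammaFive * wilsonDirac (fundamentalRep (Fin 3)) U₀ (-δ)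 1) :=
  fun hHJL hIOS => flux_periodicIndexCarrier_of hHJL hIOS

end Summit.QuantumFields.QCD.Cruxes.WindowExtinction.FreeVolumeHeavyWitness

end
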